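import Mathlib
import Summits.MatrixMultiplication.MatrixMultiplication.Theses.FidelityWitnesses
import Literature.Computability.AlgebraicComplexity.MatMulRankLowerBoundsProofs
import Literature.Computability.AlgebraicComplexity.AlderStrassen
import Literature.Computability.AlgebraicComplexity.AsymptoticRankZariskiClosedProofs
import Summits.MatrixMultiplication.MatrixMultiplication.Theorems.FidelityWitnessesSevenEighthsLawDistance
import Summits.MatrixMultiplication.MatrixMultiplication.Theorems.FidelityWitnessesSixEighthsAtFiveEffectiveKoszul
import Summits.MatrixMultiplication.MatrixMultiplication.Theorems.FidelityWitnessesSixEighthsAtFiveEffectiveBound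

/-!
# `FidelityWitnesses.SixEighthsAtFive` (stmt-MatrixMultiplication-14040) — effective bound III: `M(2,5) ≤ 15/2`

Support file for the item `SixEighthsAtFive` (`M(2,5) ≤ 6`).  Part II: `Σ|⟨2,2,2⟩ − S|² ≥ 1/4`, `M(2,5) ≤ 31/4`
for `R(S) ≤ 5`, from ONE kernel vector of the Pauli–Koszul flattening and an operator-norm bound.  Here the
rank deficiency is used in full (`rank K_Φ(S) ≤ 10` on `12` dimensions: TWO orthogonal kernel vectors `x ⊥ y`)
together with the Hilbert–Schmidt bound `Σ_{r,q} |K_Φ(D)_{rq}|² ≤ 4‖D‖²` and Bessel's inequality for the pair: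
`2‖x‖²‖y‖² ≤ ‖y‖²‖K(T)x‖² + ‖x‖²‖K(T)y‖² ≤ 4‖T−S‖²‖x‖²‖y‖²`, so `Σ|⟨2,2,2⟩ − S|² ≥ 1/2` and, polarising on
the cone of rank-`≤ 5` tensors, `‖Σ S·⟨2,2,2⟩‖² ≤ (15/2) Σ‖S‖²` (the item claims the sharp `6`).  No new definitions.
-/

set_option linter.dupNamespace false

namespace Summit.MatrixMultiplication.MatrixMultiplication.Theorems

open scoped BigOperators ComplexConjugate
open Matrix
open Literature.Computability.AlgebraicComplexity

/-- The index type `Fin 2 × Fin 2` of `2 × 2` matrices. -/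
local notation "P2" => Fin 2 × Fin 2

set_option quotPrecheck false in
/-- The `3 × 4` Pauli coordinate matrix (rows `I`, `σₓ`, `σ_z`): `Φ X = (x₀₀+x₁₁, x₀₁+x₁₀, x₀₀−x₁₁)`. -/
local notation "pauliMat" => (Matrix.of fun (j : Fin (2 * 1 + 1)) (a : Fin 2 × Fin 2) =>
    if j = 0 then (if a.1 = a.2 then (1 : ℂ) else 0)
    else if j = 1 then (if a.1 = a.2 then (0 : ℂ) else 1)
    else (if a.1 = a.2 then (if a.1 = 0 then (1 : ℂ) else -1) else 0))

set_option quotPrecheck false in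
/-- The Pauli projection `ℂ^{2×2} → ℂ³` as a linear map. -/
local notation "ΦP" => Matrix.mulVecLin pauliMat

set_option quotPrecheck false in
/-- The `p = 1` Koszul flattening after the Pauli projection (a `12 × 12` matrix, linear in the tensor). -/
local notation "KP" => koszulFlattening 1 ΦP

set_option quotPrecheck false in
/-- `⟨2,2,2⟩` over `ℂ`. -/
local notation "TT" => (matMulTensor ℂ 2 2 2)

/-- The column blocks `{0}, {1}, {2}` (`PSub 3 1`). -/
local notation "S0" => (⟨{0}, by decide⟩ : PSub (2 * 1 + 1) 1)
local notation "S1" => (⟨{1}, by decide⟩ : PSub (2 * 1 + 1) 1)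
local notation "S2" => (⟨{2}, by decide⟩ : PSub (2 * 1 + 1) 1)
/-- The row blocks `{0,1}, {0,2}, {1,2}` (`PSub 3 2`). -/
local notation "T01" => (⟨{0, 1}, by decide⟩ : PSub (2 * 1 + 1) (1 + 1))
local notation "T02" => (⟨{0, 2}, by decide⟩ : PSub (2 * 1 + 1) (1 + 1))
local notation "T12" => (⟨{1, 2}, by decide⟩ : PSub (2 * 1 + 1) (1 + 1))

/-- **Bessel for an orthogonal pair (homogeneous form).** If `Σ_q conj(x q)·y q = 0` then for every `k`:
`‖y‖²·|Σ k x|² + ‖x‖²·|Σ k y|² ≤ ‖k‖²·‖x‖²·‖y‖²` (Cauchy–Schwarz against `‖y‖² conj(Σkx)·x + ‖x‖² conj(Σky)·y`). -/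
theorem effective_pair_bessel {ι : Type*} [Fintype ι] (k x y : ι → ℂ)
    (hxy : ∑ q, conj (x q) * y q = 0) :
    (∑ q, ‖y q‖ ^ 2) * ‖∑ q, k q * x q‖ ^ 2 + (∑ q, ‖x q‖ ^ 2) * ‖∑ q, k q * y q‖ ^ 2 ≤
      (∑ q, ‖k q‖ ^ 2) * (∑ q, ‖x q‖ ^ 2) * ∑ q, ‖y q‖ ^ 2 := by
  set a : ℝ := ∑ q, ‖x q‖ ^ 2 with ha
  set b : ℝ := ∑ q, ‖y q‖ ^ 2 with hb
  set W : ℝ := ∑ q, ‖k q‖ ^ 2 with hW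
  set p : ℂ := ∑ q, k q * x q with hp
  set r : ℂ := ∑ q, k q * y q with hr
  have ha0 : 0 ≤ a := by positivity
  have hb0 : 0 ≤ b := by positivity
  set u : ι → ℂ := fun q => (b : ℂ) * conj p * x q + (a : ℂ) * conj r * y q with hu
  set L : ℝ := b * ‖p‖ ^ 2 + a * ‖r‖ ^ 2 with hL
  have hL0 : 0 ≤ L := by positivity
  -- `Σ k u = L`
  have hku : (∑ q, k q * u q) = (L : ℂ) := by
    have : (∑ q, k q * u q) = (b : ℂ) * conj p * p + (a : ℂ) * conj r * r := by
      simp only [hu, mul_add, Finset.sum_add_distrib]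
      congr 1
      · rw [hp, Finset.mul_sum]
        exact Finset.sum_congr rfl fun q _ => by ring
      · rw [hr, Finset.mul_sum]
        exact Finset.sum_congr rfl fun q _ => by ring
    rw [this, hL, Complex.ofReal_add, Complex.ofReal_mul, Complex.ofReal_mul, Complex.ofReal_pow,
      Complex.ofReal_pow, mul_assoc, Complex.conj_mul', mul_assoc, Complex.conj_mul']
  -- `Σ ‖u‖² = a b L`
  have hyx : (∑ q, x q * conj (y q)) = 0 := by
    have : (∑ q, x q * conj (y q)) = conj (∑ q, conj (x q) * y q) := by
      rw [map_sum]
      exact Finset.sum_congr rfl fun q _ => by simp [mul_comm]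
    rw [this, hxy, map_zero]
  have huu : (∑ q, ‖u q‖ ^ 2) = a * b * L := by
    have e : ∀ q, ‖u q‖ ^ 2 = b ^ 2 * ‖p‖ ^ 2 * ‖x q‖ ^ 2 + a ^ 2 * ‖r‖ ^ 2 * ‖y q‖ ^ 2 +
        2 * (((b : ℂ) * conj p * x q) * conj ((a : ℂ) * conj r * y q)).re := by
      intro q
      simp only [hu]
      rw [Complex.sq_norm, Complex.normSq_add]
      simp only [← Complex.sq_norm, norm_mul, Complex.norm_real, Complex.norm_conj, mul_pow,
        Real.norm_eq_abs, sq_abs]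
    simp only [e, Finset.sum_add_distrib, ← Finset.mul_sum, ← hb, ← ha]
    have hcross : (∑ q, (((b : ℂ) * conj p * x q) * conj ((a : ℂ) * conj r * y q)).re) = 0 := by
      rw [← Complex.re_sum]
      have : (∑ q, ((b : ℂ) * conj p * x q) * conj ((a : ℂ) * conj r * y q)) =
          (b : ℂ) * conj p * (a : ℂ) * r * ∑ q, x q * conj (y q) := by
        rw [Finset.mul_sum]
        refine Finset.sum_congr rfl fun q _ => ?_
        simp only [map_mul, Complex.conj_ofReal, Complex.conj_conj]
        ring
      rw [this, hyx, mul_zero, Complex.zero_re]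
    rw [hcross, mul_zero, add_zero, hL]
    ring
  have cs := effective_cs k u
  rw [hku, huu, Complex.norm_real, Real.norm_of_nonneg hL0] at cs
  -- `L² ≤ W a b L` ⇒ `L ≤ W a b`
  have goal : L ≤ W * a * b := by
    rcases hL0.lt_or_eq with hLpos | hL00
    · have : L * L ≤ (W * a * b) * L := by nlinarith [cs]
      exact le_of_mul_le_mul_right this hLpos
    · rw [← hL00]; positivity
  rw [hL] at goal
  linarith [goal]

/-- The three column blocks are pairwise distinct. -/
theorem effective_S_ne : (S0 ≠ S1) ∧ (S0 ≠ S2) ∧ (S1 ≠ S2) := by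
  refine ⟨?_, ?_, ?_⟩ <;> (intro h; have := congrArg Subtype.val h; revert this; decide)

/-- Entries of the flattening are `mulVec` against indicator vectors. [folklore] -/
theorem effective_entry_eq (t : P2 → P2 → P2 → ℂ) (r : PSub (2 * 1 + 1) (1 + 1) × P2)
    (q : PSub (2 * 1 + 1) 1 × P2) : KP t r q = (KP t *ᵥ Pi.single q 1) r := by
  rw [Matrix.mulVec_single_one]
  rfl

/-- A fibre sum against an indicator: `Σ_b f b · 1[(S,b) = (s,b₀)] = 1[S = s] f b₀`. [folklore] -/
theorem effective_sum_single (f : P2 → ℂ) (S s : PSub (2 * 1 + 1) 1) (b₀ : P2) :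
    (∑ b, f b * (Pi.single (s, b₀) (1 : ℂ) : PSub (2 * 1 + 1) 1 × P2 → ℂ) (S, b)) =
      if S = s then f b₀ else 0 := by
  by_cases h : S = s
  · subst h
    rw [if_pos rfl]
    have : ∀ b, (Pi.single (S, b₀) (1 : ℂ) : PSub (2 * 1 + 1) 1 × P2 → ℂ) (S, b) =
        if b = b₀ then 1 else 0 := by
      intro b
      rw [Pi.single_apply]
      simp [Prod.ext_iff]
    simp only [this, mul_ite, mul_one, mul_zero, Finset.sum_ite_eq', Finset.mem_univ, if_true]
  · rw [if_neg h]
    refine Finset.sum_eq_zero fun b _ => ?_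
    rw [Pi.single_apply, if_neg, mul_zero]
    intro hb
    exact h (Prod.ext_iff.1 hb).1

/-- Diagonal block of `effective_sum_single`. -/
theorem effective_sum_single_same (f : P2 → ℂ) (s : PSub (2 * 1 + 1) 1) (b₀ : P2) :
    (∑ b, f b * (Pi.single (s, b₀) (1 : ℂ) : PSub (2 * 1 + 1) 1 × P2 → ℂ) (s, b)) = f b₀ := by
  rw [effective_sum_single, if_pos rfl]

/-- Off-diagonal block of `effective_sum_single`. -/
theorem effective_sum_single_ne (f : P2 → ℂ) {S s : PSub (2 * 1 + 1) 1} (h : S ≠ s) (b₀ : P2) :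
    (∑ b, f b * (Pi.single (s, b₀) (1 : ℂ) : PSub (2 * 1 + 1) 1 × P2 → ℂ) (S, b)) = 0 := by
  rw [effective_sum_single, if_neg h]

/-- Row block `{0,1}`: the squared entries sum to `Σ_b (|Φ₀|² + |Φ₁|²)`. [folklore] -/
theorem effective_hs_row01 (t : P2 → P2 → P2 → ℂ) (c : P2) :
    (∑ q, ‖KP t (T01, c) q‖ ^ 2) =
      ∑ b, (‖(ΦP) (fun a => t a b c) 0‖ ^ 2 + ‖(ΦP) (fun a => t a b c) 1‖ ^ 2) := by
  obtain ⟨h01, h02, h12⟩ := effective_S_ne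
  rw [Fintype.sum_prod_type, effective_sum_PSub_one]
  simp only [effective_entry_eq, effective_row01_gen, effective_sum_single_same,
    effective_sum_single_ne _ h01.symm, effective_sum_single_ne _ h01, effective_sum_single_ne _ h12,
    effective_sum_single_ne _ h02,
    zero_sub, sub_zero, norm_neg, norm_zero, zero_pow two_ne_zero, Finset.sum_const_zero, add_zero]
  rw [← Finset.sum_add_distrib]
  exact Finset.sum_congr rfl fun b _ => by ring

/-- Row block `{0,2}`: the squared entries sum to `Σ_b (|Φ₀|² + |Φ₂|²)`. [folklore] -/
theorem effective_hs_row02 (t : P2 → P2 → P2 → ℂ) (c : P2) :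
    (∑ q, ‖KP t (T02, c) q‖ ^ 2) =
      ∑ b, (‖(ΦP) (fun a => t a b c) 0‖ ^ 2 + ‖(ΦP) (fun a => t a b c) 2‖ ^ 2) := by
  obtain ⟨h01, h02, h12⟩ := effective_S_ne
  rw [Fintype.sum_prod_type, effective_sum_PSub_one]
  simp only [effective_entry_eq, effective_row02_gen, effective_sum_single_same,
    effective_sum_single_ne _ h02.symm, effective_sum_single_ne _ h12.symm, effective_sum_single_ne _ h01,
    effective_sum_single_ne _ h02,
    zero_sub, sub_zero, norm_neg, norm_zero, zero_pow two_ne_zero, Finset.sum_const_zero, add_zero]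
  rw [← Finset.sum_add_distrib]
  exact Finset.sum_congr rfl fun b _ => by ring

/-- Row block `{1,2}`: the squared entries sum to `Σ_b (|Φ₁|² + |Φ₂|²)`. [folklore] -/
theorem effective_hs_row12 (t : P2 → P2 → P2 → ℂ) (c : P2) :
    (∑ q, ‖KP t (T12, c) q‖ ^ 2) =
      ∑ b, (‖(ΦP) (fun a => t a b c) 1‖ ^ 2 + ‖(ΦP) (fun a => t a b c) 2‖ ^ 2) := by
  obtain ⟨h01, h02, h12⟩ := effective_S_ne
  rw [Fintype.sum_prod_type, effective_sum_PSub_one]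
  simp only [effective_entry_eq, effective_row12_gen, effective_sum_single_same,
    effective_sum_single_ne _ h02.symm, effective_sum_single_ne _ h01.symm, effective_sum_single_ne _ h12.symm,
    effective_sum_single_ne _ h12,
    zero_sub, sub_zero, norm_neg, norm_zero, zero_pow two_ne_zero, Finset.sum_const_zero, zero_add]
  rw [← Finset.sum_add_distrib]
  exact Finset.sum_congr rfl fun b _ => by ring

/-- **Hilbert–Schmidt bound** `Σ_r Σ_q |K_Φ(t)_{rq}|² ≤ 4 Σ|t|²` (`= 2 Σ_{b,c} ‖Φ(t(·,b,c))‖²`, `‖Φ x‖² ≤ 2‖x‖²`). -/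
theorem effective_hs_le (t : P2 → P2 → P2 → ℂ) :
    (∑ r, ∑ q, ‖KP t r q‖ ^ 2) ≤ 4 * ∑ a, ∑ b, ∑ c, ‖t a b c‖ ^ 2 := by
  rw [Fintype.sum_prod_type, effective_sum_PSub_two]
  simp only [effective_hs_row01, effective_hs_row02, effective_hs_row12]
  rw [← Finset.sum_add_distrib, ← Finset.sum_add_distrib]
  have hre : ∀ c, (∑ b, (‖(ΦP) (fun a => t a b c) 0‖ ^ 2 + ‖(ΦP) (fun a => t a b c) 1‖ ^ 2)) +
      (∑ b, (‖(ΦP) (fun a => t a b c) 0‖ ^ 2 + ‖(ΦP) (fun a => t a b c) 2‖ ^ 2)) +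
      (∑ b, (‖(ΦP) (fun a => t a b c) 1‖ ^ 2 + ‖(ΦP) (fun a => t a b c) 2‖ ^ 2)) =
      2 * ∑ b, ∑ j, ‖(ΦP) (fun a => t a b c) j‖ ^ 2 := by
    intro c
    rw [← Finset.sum_add_distrib, ← Finset.sum_add_distrib, Finset.mul_sum]
    refine Finset.sum_congr rfl fun b _ => ?_
    rw [Fin.sum_univ_three]
    simp only [show ((0 : Fin 3)) = (0 : Fin (2 * 1 + 1)) from rfl,
      show ((1 : Fin 3)) = (1 : Fin (2 * 1 + 1)) from rfl,
      show ((2 : Fin 3)) = (2 : Fin (2 * 1 + 1)) from rfl]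
    ring
  have hT : (∑ a, ∑ b, ∑ c, ‖t a b c‖ ^ 2) = ∑ c, ∑ b, ∑ a, ‖t a b c‖ ^ 2 := by
    calc (∑ a, ∑ b, ∑ c, ‖t a b c‖ ^ 2) = ∑ a, ∑ c, ∑ b, ‖t a b c‖ ^ 2 :=
          Finset.sum_congr rfl fun a _ => Finset.sum_comm
      _ = ∑ c, ∑ a, ∑ b, ‖t a b c‖ ^ 2 := Finset.sum_comm
      _ = ∑ c, ∑ b, ∑ a, ‖t a b c‖ ^ 2 := Finset.sum_congr rfl fun c _ => Finset.sum_comm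
  calc (∑ c, ((∑ b, (‖(ΦP) (fun a => t a b c) 0‖ ^ 2 + ‖(ΦP) (fun a => t a b c) 1‖ ^ 2)) +
        (∑ b, (‖(ΦP) (fun a => t a b c) 0‖ ^ 2 + ‖(ΦP) (fun a => t a b c) 2‖ ^ 2)) +
        (∑ b, (‖(ΦP) (fun a => t a b c) 1‖ ^ 2 + ‖(ΦP) (fun a => t a b c) 2‖ ^ 2))))
      = ∑ c, 2 * ∑ b, ∑ j, ‖(ΦP) (fun a => t a b c) j‖ ^ 2 := Finset.sum_congr rfl fun c _ => hre c
    _ ≤ ∑ c, 2 * ∑ b, 2 * ∑ a, ‖t a b c‖ ^ 2 := by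
        refine Finset.sum_le_sum fun c _ => ?_
        refine mul_le_mul_of_nonneg_left (Finset.sum_le_sum fun b _ => ?_) (by norm_num)
        exact effective_pauli_norm_sq_le _
    _ = 4 * ∑ a, ∑ b, ∑ c, ‖t a b c‖ ^ 2 := by
        rw [hT, Finset.mul_sum]
        refine Finset.sum_congr rfl fun c _ => ?_
        rw [Finset.mul_sum, Finset.mul_sum]
        refine Finset.sum_congr rfl fun b _ => ?_
        ring

/-- **Bessel, summed over the rows**: for `x ⊥ y`,
`‖y‖² Σ_r |(K x)_r|² + ‖x‖² Σ_r |(K y)_r|² ≤ (Σ_{r,q} |K_{rq}|²) ‖x‖² ‖y‖²`. [folklore] -/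
theorem effective_pair_rows (t : P2 → P2 → P2 → ℂ) (x y : PSub (2 * 1 + 1) 1 × P2 → ℂ)
    (hxy : ∑ q, conj (x q) * y q = 0) :
    (∑ q, ‖y q‖ ^ 2) * (∑ r, ‖(KP t *ᵥ x) r‖ ^ 2) + (∑ q, ‖x q‖ ^ 2) * (∑ r, ‖(KP t *ᵥ y) r‖ ^ 2) ≤
      (∑ r, ∑ q, ‖KP t r q‖ ^ 2) * (∑ q, ‖x q‖ ^ 2) * ∑ q, ‖y q‖ ^ 2 := by
  have hrow : ∀ (z : PSub (2 * 1 + 1) 1 × P2 → ℂ) (r), (KP t *ᵥ z) r = ∑ q, KP t r q * z q := by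
    intro z r
    rfl
  simp only [hrow]
  rw [Finset.mul_sum, Finset.mul_sum, ← Finset.sum_add_distrib, Finset.sum_mul, Finset.sum_mul]
  exact Finset.sum_le_sum fun r _ => effective_pair_bessel (fun q => KP t r q) x y hxy

/-- **Rank `≤ 5` gives an orthogonal PAIR of kernel vectors** of the Pauli–Koszul flattening (`rank ≤ 10` on
`12` dimensions: the kernel has dimension `≥ 2` and meets the orthogonal hyperplane of its first vector). -/
theorem effective_exists_kernel_pair (S : P2 → P2 → P2 → ℂ) (hS : tensorRank S ≤ 5) :
    ∃ x y : PSub (2 * 1 + 1) 1 × P2 → ℂ, x ≠ 0 ∧ y ≠ 0 ∧ KP S *ᵥ x = 0 ∧ KP S *ᵥ y = 0 ∧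
      ∑ q, conj (x q) * y q = 0 := by
  obtain ⟨w, u, v, hdec⟩ := exists_eq_sum_triad_of_tensorRank_le hS
  have hrank : (KP S).rank ≤ 10 := by
    rw [hdec]
    exact (rank_koszulFlattening_sum_triad_le 1 (ΦP) w u v).trans (by norm_num [Nat.choose])
  set M := KP S with hM
  have hcard : Module.finrank ℂ (PSub (2 * 1 + 1) 1 × P2 → ℂ) = 12 := by
    rw [Module.finrank_fintype_fun_eq_card, Fintype.card_prod, card_PSub, Fintype.card_prod,
      Fintype.card_fin]
    rfl
  have hrn := LinearMap.finrank_range_add_finrank_ker M.mulVecLin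
  rw [hcard] at hrn
  have hr : Module.finrank ℂ (LinearMap.range M.mulVecLin) ≤ 10 := hrank
  have hker : 2 ≤ Module.finrank ℂ (LinearMap.ker M.mulVecLin) := by omega
  -- a first non-zero kernel vector
  have hne : LinearMap.ker M.mulVecLin ≠ ⊥ := by
    intro h
    rw [h, finrank_bot] at hker
    omega
  obtain ⟨x, hx, hx0⟩ := Submodule.exists_mem_ne_zero_of_ne_bot hne
  -- the hyperplane orthogonal to `x`
  set φ : (PSub (2 * 1 + 1) 1 × P2 → ℂ) →ₗ[ℂ] (Unit → ℂ) :=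
    Matrix.mulVecLin (Matrix.of fun (_ : Unit) q => conj (x q)) with hφ
  have hφker : 11 ≤ Module.finrank ℂ (LinearMap.ker φ) := by
    have h1 := LinearMap.finrank_range_add_finrank_ker φ
    rw [hcard] at h1
    have h2 : Module.finrank ℂ (LinearMap.range φ) ≤ 1 := by
      calc Module.finrank ℂ (LinearMap.range φ) ≤ Module.finrank ℂ (Unit → ℂ) :=
            Submodule.finrank_le _
        _ = 1 := by simp
    omega
  -- the intersection is non-trivial
  have hinf : 1 ≤ Module.finrank ℂ ↥(LinearMap.ker M.mulVecLin ⊓ LinearMap.ker φ) := by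
    have h1 := Submodule.finrank_sup_add_finrank_inf_eq (LinearMap.ker M.mulVecLin) (LinearMap.ker φ)
    have h2 : Module.finrank ℂ ↥(LinearMap.ker M.mulVecLin ⊔ LinearMap.ker φ) ≤ 12 := by
      rw [← hcard]; exact Submodule.finrank_le _
    omega
  have hne2 : LinearMap.ker M.mulVecLin ⊓ LinearMap.ker φ ≠ ⊥ := by
    intro h
    rw [h, finrank_bot] at hinf
    omega
  obtain ⟨y, hy, hy0⟩ := Submodule.exists_mem_ne_zero_of_ne_bot hne2
  rw [Submodule.mem_inf] at hy
  refine ⟨x, y, hx0, hy0, by simpa [LinearMap.mem_ker] using hx,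
    by simpa [LinearMap.mem_ker] using hy.1, ?_⟩
  have hφy : φ y = 0 := by simpa [LinearMap.mem_ker] using hy.2
  have := congrFun hφy ()
  simpa [hφ, Matrix.mulVecLin_apply, Matrix.mulVec, dotProduct] using this

/-- **Every tensor of rank `≤ 5` lies at squared Frobenius distance `≥ 1/2` from `⟨2,2,2⟩`** (two orthogonal
kernel vectors, Bessel, Hilbert–Schmidt).  Part II had `1/4`; the item's sharp value is `2`. [folklore] -/
theorem sixEighthsAtFive_dist_sq_ge_half (S : P2 → P2 → P2 → ℂ) (hS : tensorRank S ≤ 5) :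
    (1 / 2 : ℝ) ≤ ∑ a, ∑ b, ∑ c, ‖matMulTensor ℂ 2 2 2 a b c - S a b c‖ ^ 2 := by
  obtain ⟨x, y, hx0, hy0, hKx, hKy, hxy⟩ := effective_exists_kernel_pair S hS
  obtain ⟨D, hD⟩ : ∃ D : P2 → P2 → P2 → ℂ, D = fun a b c => TT a b c - S a b c := ⟨_, rfl⟩
  have hTD : TT = D + S := by
    rw [hD]
    funext a b c
    simp
  have hKxD : KP TT *ᵥ x = KP D *ᵥ x := by
    rw [hTD, koszulFlattening_add, Matrix.add_mulVec, hKx, add_zero]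
  have hKyD : KP TT *ᵥ y = KP D *ᵥ y := by
    rw [hTD, koszulFlattening_add, Matrix.add_mulVec, hKy, add_zero]
  set nx : ℝ := ∑ q, ‖x q‖ ^ 2 with hnx
  set ny : ℝ := ∑ q, ‖y q‖ ^ 2 with hny
  set dd : ℝ := ∑ a, ∑ b, ∑ c, ‖D a b c‖ ^ 2 with hdd
  have hpos : ∀ z : PSub (2 * 1 + 1) 1 × P2 → ℂ, z ≠ 0 → 0 < ∑ q, ‖z q‖ ^ 2 := by
    intro z hz
    obtain ⟨q, hq⟩ : ∃ q, z q ≠ 0 := Function.ne_iff.mp hz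
    have hq' : 0 < ‖z q‖ ^ 2 := by positivity
    exact lt_of_lt_of_le hq'
      (Finset.single_le_sum (f := fun q => ‖z q‖ ^ 2) (fun q _ => by positivity) (Finset.mem_univ q))
  have hnx0 : 0 < nx := hpos x hx0
  have hny0 : 0 < ny := hpos y hy0
  have hlx : nx ≤ ∑ r, ‖(KP D *ᵥ x) r‖ ^ 2 := by
    have := effective_lower_bound x
    rwa [hKxD] at this
  have hly : ny ≤ ∑ r, ‖(KP D *ᵥ y) r‖ ^ 2 := by
    have := effective_lower_bound y
    rwa [hKyD] at this
  have hpair := effective_pair_rows D x y hxy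
  have hhs := effective_hs_le D
  -- `2 nx ny ≤ 4 dd nx ny`
  have h1 : ny * nx + nx * ny ≤ (∑ r, ∑ q, ‖KP D r q‖ ^ 2) * nx * ny := by
    calc ny * nx + nx * ny ≤ ny * (∑ r, ‖(KP D *ᵥ x) r‖ ^ 2) + nx * ∑ r, ‖(KP D *ᵥ y) r‖ ^ 2 :=
          add_le_add (mul_le_mul_of_nonneg_left hlx hny0.le) (mul_le_mul_of_nonneg_left hly hnx0.le)
      _ ≤ (∑ r, ∑ q, ‖KP D r q‖ ^ 2) * nx * ny := hpair
  have h2 : (∑ r, ∑ q, ‖KP D r q‖ ^ 2) * nx * ny ≤ 4 * dd * nx * ny := by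
    have hxy0 : 0 ≤ nx * ny := by positivity
    nlinarith [hhs, hxy0]
  have h3 : 2 * (nx * ny) ≤ (4 * dd) * (nx * ny) := by nlinarith [h1, h2]
  have h4 : (2 : ℝ) ≤ 4 * dd := le_of_mul_le_mul_right h3 (by positivity)
  rw [hdd, hD] at h4
  linarith

/-- **The second effective bound at `(2,5)`: `‖Σ S·⟨2,2,2⟩‖² ≤ (15/2) Σ‖S‖²` for `R(S) ≤ 5`** (`M(2,5) ≤ 7.5`;
part II had `7.75`; the item claims `6`); the distance bound polarised on the cone of rank-`≤ 5` tensors. -/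
theorem sixEighthsAtFive_effective_half (S : P2 → P2 → P2 → ℂ) (hS : tensorRank S ≤ 5) :
    ‖∑ a, ∑ b, ∑ c, S a b c * matMulTensor ℂ 2 2 2 a b c‖ ^ 2 ≤
      (15 / 2) * ∑ a, ∑ b, ∑ c, ‖S a b c‖ ^ 2 := by
  set N : ℝ := ∑ a, ∑ b, ∑ c, ‖S a b c‖ ^ 2 with hN
  set B : ℂ := ∑ a, ∑ b, ∑ c, S a b c * matMulTensor ℂ 2 2 2 a b c with hBdef
  have hN0 : 0 ≤ N := by positivity
  rcases hN0.lt_or_eq with hNpos | hN00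
  · set lam : ℂ := conj B / (N : ℂ) with hlam
    have key := sixEighthsAtFive_dist_sq_ge_half (lam • S) ((tensorRank_smul_le lam S).trans hS)
    rw [SevenEighthsLaw.sevenEighthsLaw_dist_sq_expand] at key
    have hNl : (∑ a, ∑ b, ∑ c, ‖(lam • S) a b c‖ ^ 2) = ‖lam‖ ^ 2 * N := by
      simp only [Pi.smul_apply, smul_eq_mul, norm_mul, mul_pow, hN, Finset.mul_sum]
    have hBl : (∑ a, ∑ b, ∑ c, (lam • S) a b c * matMulTensor ℂ 2 2 2 a b c) = lam * B := by
      simp only [Pi.smul_apply, smul_eq_mul, hBdef, Finset.mul_sum, mul_assoc]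
    rw [hNl, hBl] at key
    have h1 : ‖lam‖ ^ 2 * N = ‖B‖ ^ 2 / N := by
      rw [hlam, norm_div, Complex.norm_conj, Complex.norm_real, Real.norm_of_nonneg hNpos.le]
      field_simp
    have h2 : (lam * B).re = ‖B‖ ^ 2 / N := by
      have : lam * B = ((‖B‖ ^ 2 / N : ℝ) : ℂ) := by
        rw [hlam, div_mul_eq_mul_div, Complex.conj_mul']
        push_cast
        ring
      rw [this, Complex.ofReal_re]
    rw [h1, h2] at key
    have h3 : ‖B‖ ^ 2 / N ≤ 15 / 2 := by linarith
    rw [div_le_iff₀ hNpos] at h3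
    linarith
  · have hS0 : ∀ a b c, S a b c = 0 := by
      intro a b c
      have hsum : (∑ a, ∑ b, ∑ c, ‖S a b c‖ ^ 2) = 0 := hN00.symm
      have ha := (Finset.sum_eq_zero_iff_of_nonneg fun a _ => by positivity).1 hsum a
        (Finset.mem_univ a)
      have hb := (Finset.sum_eq_zero_iff_of_nonneg fun b _ => by positivity).1 ha b
        (Finset.mem_univ b)
      have hc := (Finset.sum_eq_zero_iff_of_nonneg fun c _ => by positivity).1 hb c
        (Finset.mem_univ c)
      simpa using hc
    have hB0 : B = 0 := by
      rw [hBdef]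
      exact Finset.sum_eq_zero fun a _ => Finset.sum_eq_zero fun b _ =>
        Finset.sum_eq_zero fun c _ => by rw [hS0 a b c, zero_mul]
    rw [hB0, ← hN00]
    simp

end Summit.MatrixMultiplication.MatrixMultiplication.Theorems
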